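import Literature.NumberTheory.LFunctions.ZetaZeroDensityVinogradovKorobovEdge
import Literature.NumberTheory.LFunctions.MertensErrorTermsMeanValueRHThetaTailParts
import Literature.NumberTheory.LFunctions.SchoenfeldExplicit
import Mathlib.Analysis.Convex.SpecificFunctions.Basic
import HarnessLib

/-!
# RH-FREE — The `ϑ → π` transfer with the SAME Korobov–Vinogradov exponent, and Bellotti 2026 Cor. 1.6 from Thm 1.5 («nothing here bears on the truth of RH»)

Topic `Literature/NumberTheory/LFunctions` (RH literature-typing tranche 1, L4 "explicit zero
statistics", gen 10). Label **RH-FREE**. THEOREMS only (no definitions, no named facts). Nothing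
here bears on the truth of RH.

Bellotti (Bull. Lond. Math. Soc. 58 (2026), no. 7, Cor. 1.6) passes from
`Δ(x) = |ψ(x) − x|/x ≪ e^{−ω(x)}`, `ω(x) = d (log x)^{3/5}(log log x)^{−1/5}`, to the same bound for
`Δ₂ = |ϑ(x) − x|/x` and `Δ₁ = |π(x) − li x|/(x/log x)` as an "immediate corollary" — with the SAME
constant `d` in the exponent. The tree's generic passage `ϑ → π` (Ivić (12.27),
`primeCounting_sub_logIntegral_vinogradovKorobov`, splitting `∫₂ˣ` at `√x`) halves the exponent
constant; here the same-exponent transfer is proved, by the monotonicity of `u ↦ √u · e^{−ω(u)}`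
(eventually increasing: `ω(x) − ω(u) ≤ (3d/5)(log u)^{−2/5}(log x − log u)` by Bernoulli's inequality
for the exponent `3/5`), Schoenfeld's form of the partial-summation identity
`π(x) − li x = (ϑ(x) − x)/log x + ∫_ξ^x (ϑ(t) − t) dt/(t log²t) − ξ'` (`SchoenfeldExplicit.lean`) and the
tree's `∫_a^x dt/(√t log²t) ≤ 4√x/log²x` (`Zhao2025.integral_inv_sqrt_mul_log_sq_le`):

* `VKTransfer.vkShape_sub_le` — `d (L(x) − L(u)) ≤ (log x − log u)/2` for `e^{ℓ₀} ≤ u ≤ x`,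
  `L(y) = (log y)^{3/5}(log log y)^{−1/5}`, `ℓ₀ = max 8 ((6d/5)^{5/2})`;
* `VKTransfer.exp_neg_le_sqrt_div` — hence `e^{−dL(u)} ≤ √(x/u) · e^{−dL(x)}` there;
* **`VKTransfer.primeCounting_of_theta`** — if `|ϑ(u) − u| ≤ C u e^{−dL(u)}` for `u ≥ x₀` (`d > 0`,
  `C ≥ 0`) then `|π(x) − li x| ≤ C' (x/log x) e^{−dL(x)}` for `x ≥ x₁`, with the SAME `d`;
* **`Bellotti2026_thm15.primeCounting`**, **`Bellotti2026_thm15.cor16 : Bellotti2026_thm15 → Bellotti2026_cor16`**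
  — Corollary 1.6 (both clauses) is a CONSEQUENCE of Theorem 1.5 in the tree (the `ϑ`-clause is
  `Bellotti2026_thm15.theta` of `ZetaZeroDensityVinogradovKorobovEdge.lean`).

## References

* C. Bellotti, Bull. Lond. Math. Soc. 58 (2026), no. 7 = arXiv:2508.02041v1, Thm 1.5, Cor. 1.6.
  [Bellotti2026ZeroDensity]
* A. Ivić, *The Riemann Zeta-Function*, Wiley 1985, Thm 12.2 eqs. (12.26)–(12.27). [Ivic1985]
* L. Schoenfeld, Math. Comp. 30 (1976) 337–360, (6.19a)–(6.19b). [Schoenfeld1976]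
-/

noncomputable section

open Real Filter Set MeasureTheory intervalIntegral
open scoped Chebyshev

namespace Literature.NumberTheory.LFunctions

namespace VKTransfer

/-- Bernoulli for the exponent `3/5`: for `0 < a ≤ b`, `b^{3/5} − a^{3/5} ≤ (3/5)(a^{3/5}/a)(b − a)`.
[folklore] -/
private theorem rpow_three_fifths_sub_le {a b : ℝ} (ha : 0 < a) (hab : a ≤ b) :
    b ^ (3 / 5 : ℝ) - a ^ (3 / 5 : ℝ) ≤ 3 / 5 * (a ^ (3 / 5 : ℝ) / a) * (b - a) := by
  set s : ℝ := (b - a) / a with hs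
  have hs0 : 0 ≤ s := div_nonneg (by linarith) ha.le
  have hb : b = a * (1 + s) := by rw [hs]; field_simp; ring
  have hbern : (1 + s) ^ (3 / 5 : ℝ) ≤ 1 + 3 / 5 * s :=
    rpow_one_add_le_one_add_mul_self (by linarith) (by norm_num) (by norm_num)
  have ha35 : 0 ≤ a ^ (3 / 5 : ℝ) := Real.rpow_nonneg ha.le _
  rw [hb, Real.mul_rpow ha.le (by linarith)]
  have : a ^ (3 / 5 : ℝ) * (1 + s) ^ (3 / 5 : ℝ) ≤ a ^ (3 / 5 : ℝ) * (1 + 3 / 5 * s) :=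
    mul_le_mul_of_nonneg_left hbern ha35
  have e : 3 / 5 * (a ^ (3 / 5 : ℝ) / a) * (a * (1 + s) - a) = a ^ (3 / 5 : ℝ) * (3 / 5 * s) := by
    rw [hs]; field_simp; ring
  rw [e]; linarith

/-- **The exponent increment**: for `e^{ℓ₀} ≤ u ≤ x`, `ℓ₀ = max 8 ((6d/5)^{5/2})`, `d ≥ 0`,
`d((log x)^{3/5}(log log x)^{−1/5} − (log u)^{3/5}(log log u)^{−1/5}) ≤ (log x − log u)/2`
(drop `(log log x)^{−1/5} ≤ (log log u)^{−1/5} ≤ 1`, then Bernoulli and `(log u)^{2/5} ≥ 6d/5`).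
[cite: Bellotti2026ZeroDensity, Cor. 1.6] -/
theorem vkShape_sub_le {d u x : ℝ} (hd : 0 ≤ d)
    (hu : Real.exp (max 8 ((6 * d / 5) ^ (5 / 2 : ℝ))) ≤ u) (hux : u ≤ x) :
    d * (Real.log x ^ (3 / 5 : ℝ) * Real.log (Real.log x) ^ (-(1 / 5) : ℝ) -
        Real.log u ^ (3 / 5 : ℝ) * Real.log (Real.log u) ^ (-(1 / 5) : ℝ)) ≤
      (Real.log x - Real.log u) / 2 := by
  set ℓ₀ : ℝ := max 8 ((6 * d / 5) ^ (5 / 2 : ℝ)) with hℓ₀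
  have hu0 : 0 < u := (Real.exp_pos _).trans_le hu
  have hx0 : 0 < x := hu0.trans_le hux
  set a := Real.log u with ha
  set b := Real.log x with hb
  have haℓ : ℓ₀ ≤ a := by rw [ha, ← Real.log_exp ℓ₀]; exact Real.log_le_log (Real.exp_pos _) hu
  have ha8 : 8 ≤ a := (le_max_left _ _).trans haℓ
  have hab : a ≤ b := Real.log_le_log hu0 hux
  have ha0 : 0 < a := by linarith
  -- `log a ≥ 1` (as `a ≥ 8 > e`)
  have hla1 : 1 ≤ Real.log a := by
    rw [← Real.log_exp 1]
    refine Real.log_le_log (Real.exp_pos 1) ?_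
    have := Real.exp_one_lt_d9; linarith
  have hla0 : 0 < Real.log a := by linarith
  have hlb : Real.log a ≤ Real.log b := Real.log_le_log ha0 hab
  -- the `(log log)^{-1/5}` factors
  have h1 : Real.log b ^ (-(1 / 5) : ℝ) ≤ Real.log a ^ (-(1 / 5) : ℝ) :=
    Real.rpow_le_rpow_of_nonpos hla0 hlb (by norm_num)
  have h2 : Real.log a ^ (-(1 / 5) : ℝ) ≤ 1 := Real.rpow_le_one_of_one_le_of_nonpos hla1 (by norm_num)
  have h2' : 0 ≤ Real.log a ^ (-(1 / 5) : ℝ) := Real.rpow_nonneg hla0.le _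
  have hb35 : 0 ≤ b ^ (3 / 5 : ℝ) := Real.rpow_nonneg (by linarith) _
  have ha35 : 0 ≤ a ^ (3 / 5 : ℝ) := Real.rpow_nonneg ha0.le _
  have hmono35 : a ^ (3 / 5 : ℝ) ≤ b ^ (3 / 5 : ℝ) := Real.rpow_le_rpow ha0.le hab (by norm_num)
  -- `g(b) − g(a) ≤ b^{3/5} − a^{3/5}`
  have hdiff : b ^ (3 / 5 : ℝ) * Real.log b ^ (-(1 / 5) : ℝ) - a ^ (3 / 5 : ℝ) * Real.log a ^ (-(1 / 5) : ℝ)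
      ≤ b ^ (3 / 5 : ℝ) - a ^ (3 / 5 : ℝ) := by
    have s1 : b ^ (3 / 5 : ℝ) * Real.log b ^ (-(1 / 5) : ℝ) ≤ b ^ (3 / 5 : ℝ) * Real.log a ^ (-(1 / 5) : ℝ) :=
      mul_le_mul_of_nonneg_left h1 hb35
    have s2 : b ^ (3 / 5 : ℝ) * Real.log a ^ (-(1 / 5) : ℝ) - a ^ (3 / 5 : ℝ) * Real.log a ^ (-(1 / 5) : ℝ)
        = (b ^ (3 / 5 : ℝ) - a ^ (3 / 5 : ℝ)) * Real.log a ^ (-(1 / 5) : ℝ) := by ring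
    have s3 : (b ^ (3 / 5 : ℝ) - a ^ (3 / 5 : ℝ)) * Real.log a ^ (-(1 / 5) : ℝ) ≤
        (b ^ (3 / 5 : ℝ) - a ^ (3 / 5 : ℝ)) * 1 :=
      mul_le_mul_of_nonneg_left h2 (by linarith)
    linarith
  -- Bernoulli and the threshold `a^{2/5} ≥ 6d/5`
  have hbern := rpow_three_fifths_sub_le ha0 hab
  have hthr : d * (3 / 5 * (a ^ (3 / 5 : ℝ) / a)) ≤ 1 / 2 := by
    -- `a ≥ (6d/5)^{5/2}` ⟹ `a^{2/5} ≥ 6d/5` ⟹ `d · a^{3/5} ≤ (5/6) a`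
    have hA : (6 * d / 5) ^ (5 / 2 : ℝ) ≤ a := (le_max_right _ _).trans haℓ
    have h25 : 6 * d / 5 ≤ a ^ (2 / 5 : ℝ) := by
      have h := Real.rpow_le_rpow (by positivity) hA (show (0 : ℝ) ≤ 2 / 5 by norm_num)
      rwa [← Real.rpow_mul (by positivity), show (5 / 2 : ℝ) * (2 / 5) = 1 by norm_num,
        Real.rpow_one] at h
    have hsplit : a ^ (2 / 5 : ℝ) * a ^ (3 / 5 : ℝ) = a := by
      rw [← Real.rpow_add ha0]; norm_num
    have hkey : d * a ^ (3 / 5 : ℝ) ≤ 5 / 6 * a := by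
      have := mul_le_mul_of_nonneg_right h25 ha35
      rw [hsplit] at this
      linarith
    rw [show d * (3 / 5 * (a ^ (3 / 5 : ℝ) / a)) = 3 / 5 * (d * a ^ (3 / 5 : ℝ)) / a by ring,
      div_le_iff₀ ha0]
    linarith
  have hba : 0 ≤ b - a := by linarith
  calc d * (b ^ (3 / 5 : ℝ) * Real.log b ^ (-(1 / 5) : ℝ) - a ^ (3 / 5 : ℝ) * Real.log a ^ (-(1 / 5) : ℝ))
      ≤ d * (b ^ (3 / 5 : ℝ) - a ^ (3 / 5 : ℝ)) := mul_le_mul_of_nonneg_left hdiff hd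
    _ ≤ d * (3 / 5 * (a ^ (3 / 5 : ℝ) / a) * (b - a)) := mul_le_mul_of_nonneg_left hbern hd
    _ = d * (3 / 5 * (a ^ (3 / 5 : ℝ) / a)) * (b - a) := by ring
    _ ≤ 1 / 2 * (b - a) := mul_le_mul_of_nonneg_right hthr hba
    _ = (b - a) / 2 := by ring

/-- **`u ↦ √u e^{−dL(u)}` is increasing beyond `e^{ℓ₀}`**, in the form used below: for
`e^{ℓ₀} ≤ u ≤ x`, `e^{−dL(u)} ≤ √x e^{−dL(x)} (√u)⁻¹`. [cite: Bellotti2026ZeroDensity, Cor. 1.6] -/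
theorem exp_neg_le_sqrt_div {d u x : ℝ} (hd : 0 ≤ d)
    (hu : Real.exp (max 8 ((6 * d / 5) ^ (5 / 2 : ℝ))) ≤ u) (hux : u ≤ x) :
    Real.exp (-(d * Real.log u ^ (3 / 5 : ℝ) * Real.log (Real.log u) ^ (-(1 / 5) : ℝ))) ≤
      Real.sqrt x * Real.exp (-(d * Real.log x ^ (3 / 5 : ℝ) * Real.log (Real.log x) ^ (-(1 / 5) : ℝ))) *
        (Real.sqrt u)⁻¹ := by
  have hu0 : 0 < u := (Real.exp_pos _).trans_le hu
  have hx0 : 0 < x := hu0.trans_le hux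
  have hkey := vkShape_sub_le hd hu hux
  have hsu : Real.sqrt u = Real.exp (Real.log u / 2) := by
    rw [Real.sqrt_eq_rpow, Real.rpow_def_of_pos hu0]; ring_nf
  have hsx : Real.sqrt x = Real.exp (Real.log x / 2) := by
    rw [Real.sqrt_eq_rpow, Real.rpow_def_of_pos hx0]; ring_nf
  rw [hsu, hsx, ← Real.exp_neg, ← Real.exp_add, ← Real.exp_add, Real.exp_le_exp]
  nlinarith [hkey]

/-- **The same-exponent `ϑ → π` transfer for Korobov–Vinogradov error terms**: if
`|ϑ(u) − u| ≤ C u exp(−d (log u)^{3/5}(log log u)^{−1/5})` for all `u ≥ x₀` (`d > 0`, `C ≥ 0`), then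
there are `C', x₁` with `|π(x) − li x| ≤ C' (x/log x) exp(−d (log x)^{3/5}(log log x)^{−1/5})` for all
`x ≥ x₁` — the SAME `d` (`π(x) = Nat.primeCounting ⌊x⌋₊`, `li = logIntegral`). Via Schoenfeld's
partial-summation identity from `ξ = max(x₀, 2, e^{ℓ₀})`, the monotonicity `exp_neg_le_sqrt_div`
inside `∫_ξ^x`, `∫_ξ^x dt/(√t log²t) ≤ 4√x/log²x`, and `√x log x ≤ x e^{−dL(x)}` eventually
(`Bellotti2026.eventually_sqrt_mul_log_le`) to absorb the constant `ξ'`.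
[cite: Bellotti2026ZeroDensity, Cor. 1.6] [cite: Ivic1985, Theorem 12.2 eq. (12.27)]
[cite: Schoenfeld1976, (6.19a)–(6.19b)] -/
theorem primeCounting_of_theta {d C x₀ : ℝ} (hd : 0 < d) (hC : 0 ≤ C)
    (hθ : ∀ u : ℝ, x₀ ≤ u →
      |θ u - u| ≤ C * u * Real.exp (-(d * Real.log u ^ (3 / 5 : ℝ) * Real.log (Real.log u) ^ (-(1 / 5) : ℝ)))) :
    ∃ C' x₁ : ℝ, ∀ x : ℝ, x₁ ≤ x →
      |(Nat.primeCounting ⌊x⌋₊ : ℝ) - logIntegral x| ≤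
        C' * (x / Real.log x) *
          Real.exp (-(d * Real.log x ^ (3 / 5 : ℝ) * Real.log (Real.log x) ^ (-(1 / 5) : ℝ))) := by
  -- notation
  set E : ℝ → ℝ := fun y ↦
    Real.exp (-(d * Real.log y ^ (3 / 5 : ℝ) * Real.log (Real.log y) ^ (-(1 / 5) : ℝ))) with hE
  have hE0 : ∀ y, 0 < E y := fun y ↦ Real.exp_pos _
  -- the lower limit `ξ`
  set ℓ₀ : ℝ := max 8 ((6 * d / 5) ^ (5 / 2 : ℝ)) with hℓ₀
  set ξ : ℝ := max (max x₀ 2) (Real.exp ℓ₀) with hξ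
  have hξ2 : 2 ≤ ξ := (le_max_right _ _).trans (le_max_left _ _)
  have hξx₀ : x₀ ≤ ξ := (le_max_left _ _).trans (le_max_left _ _)
  have hξe : Real.exp ℓ₀ ≤ ξ := le_max_right _ _
  have hξ8 : Real.exp 8 ≤ ξ := (Real.exp_le_exp.2 (le_max_left _ _)).trans hξe
  have hξ0 : 0 < ξ := by linarith
  -- absorb the constant: `√x log x ≤ x E(x)` eventually
  obtain ⟨x₂, hx₂⟩ := (Bellotti2026.eventually_sqrt_mul_log_le hd.le).exists_forall_of_atTop
  -- Schoenfeld's constant `ξ'`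
  set K : ℝ := (logIntegral ξ - Nat.primeCounting ⌊ξ⌋₊) - (ξ - θ ξ) / Real.log ξ with hK
  refine ⟨C + 4 * C + |K|, max ξ x₂, fun x hx ↦ ?_⟩
  have hξx : ξ ≤ x := (le_max_left _ _).trans hx
  have hx2x : x₂ ≤ x := (le_max_right _ _).trans hx
  have hx0 : 0 < x := hξ0.trans_le hξx
  have hx1 : 1 ≤ x := by linarith
  have hlogx8 : 8 ≤ Real.log x := by
    rw [← Real.log_exp 8]; exact Real.log_le_log (Real.exp_pos 8) (hξ8.trans hξx)
  have hlogx : 1 ≤ Real.log x := by linarith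
  have hlogx0 : 0 < Real.log x := by linarith
  -- the identity
  have hid := primeCounting_sub_logIntegral_eq hξ2 hξx
  -- (1) the boundary term
  have hbdry : |(θ x - x) / Real.log x| ≤ C * (x / Real.log x) * E x := by
    rw [abs_div, abs_of_pos hlogx0, div_le_iff₀ hlogx0]
    have := hθ x (hξx₀.trans hξx)
    calc |θ x - x| ≤ C * x * E x := this
      _ = C * (x / Real.log x) * E x * Real.log x := by field_simp
  -- (2) the integral
  have hint : |∫ t in ξ..x, (θ t - t) / (t * Real.log t ^ 2)| ≤ 4 * C * (x / Real.log x ^ 2) * E x := by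
    -- pointwise bound on `[ξ, x]`
    have hpt : ∀ t ∈ Icc ξ x, ‖(θ t - t) / (t * Real.log t ^ 2)‖ ≤
        C * Real.sqrt x * E x * (Real.sqrt t * Real.log t ^ 2)⁻¹ := by
      intro t ht
      have ht0 : 0 < t := hξ0.trans_le ht.1
      have hlogt : 0 < Real.log t := Real.log_pos (by linarith [ht.1])
      have hst : 0 < Real.sqrt t := Real.sqrt_pos.2 ht0
      have h1 := hθ t (hξx₀.trans ht.1)
      have h2 := exp_neg_le_sqrt_div hd.le (hξe.trans ht.1) ht.2
      rw [Real.norm_eq_abs, abs_div, abs_of_pos (by positivity : 0 < t * Real.log t ^ 2),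
        div_le_iff₀ (by positivity)]
      calc |θ t - t| ≤ C * t * E t := h1
        _ ≤ C * t * (Real.sqrt x * E x * (Real.sqrt t)⁻¹) :=
            mul_le_mul_of_nonneg_left h2 (by positivity)
        _ = C * Real.sqrt x * E x * (Real.sqrt t * Real.log t ^ 2)⁻¹ * (t * Real.log t ^ 2) := by
            field_simp
    have hθint : IntervalIntegrable (fun t ↦ (θ t - t) / (t * Real.log t ^ 2)) volume ξ x := by
      rw [intervalIntegrable_iff_integrableOn_Icc_of_le hξx]
      have h1 : IntegrableOn (fun t ↦ θ t / (t * Real.log t ^ 2)) (Icc ξ x) volume :=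
        (Chebyshev.integrableOn_theta_div_id_mul_log_sq x).mono_set (Icc_subset_Icc_left hξ2)
      have h2 : IntegrableOn (fun t : ℝ ↦ t / (t * Real.log t ^ 2)) (Icc ξ x) volume := by
        refine ContinuousOn.integrableOn_Icc (continuousOn_of_forall_continuousAt fun t ht ↦ ?_)
        have ht0 : t ≠ 0 := (hξ0.trans_le ht.1).ne'
        have hl : Real.log t ≠ 0 := (Real.log_pos (by linarith [ht.1])).ne'
        have : t * Real.log t ^ 2 ≠ 0 := mul_ne_zero ht0 (pow_ne_zero _ hl)
        fun_prop (disch := assumption)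
      have := h1.sub h2
      refine this.congr_fun (fun t _ ↦ ?_) measurableSet_Icc
      simp only [Pi.sub_apply]; ring
    have hgcont : ContinuousOn (fun t : ℝ ↦ C * Real.sqrt x * E x * (Real.sqrt t * Real.log t ^ 2)⁻¹)
        (uIcc ξ x) := by
      rw [uIcc_of_le hξx]
      refine continuousOn_of_forall_continuousAt fun t ht ↦ ?_
      have ht0 : 0 < t := hξ0.trans_le ht.1
      have hl : Real.log t ≠ 0 := (Real.log_pos (by linarith [ht.1])).ne'
      have h3 : Real.sqrt t * Real.log t ^ 2 ≠ 0 := mul_ne_zero (Real.sqrt_pos.2 ht0).ne' (pow_ne_zero _ hl)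
      have ht0' : t ≠ 0 := ht0.ne'
      fun_prop (disch := assumption)
    have hgint : IntervalIntegrable (fun t : ℝ ↦ C * Real.sqrt x * E x * (Real.sqrt t * Real.log t ^ 2)⁻¹)
        volume ξ x := hgcont.intervalIntegrable
    have hle := intervalIntegral.norm_integral_le_of_norm_le hξx
      (ae_of_all _ fun t ht ↦ hpt t ⟨ht.1.le, ht.2⟩) hgint
    rw [Real.norm_eq_abs] at hle
    refine hle.trans ?_
    rw [intervalIntegral.integral_const_mul]
    have hI := Zhao2025.integral_inv_sqrt_mul_log_sq_le hξ8 hξx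
    have hpos : 0 ≤ C * Real.sqrt x * E x := by positivity
    calc C * Real.sqrt x * E x * ∫ t in ξ..x, (Real.sqrt t * Real.log t ^ 2)⁻¹
        ≤ C * Real.sqrt x * E x * (4 * Real.sqrt x / Real.log x ^ 2) := mul_le_mul_of_nonneg_left hI hpos
      _ = 4 * C * ((Real.sqrt x * Real.sqrt x) / Real.log x ^ 2) * E x := by ring
      _ = 4 * C * (x / Real.log x ^ 2) * E x := by rw [Real.mul_self_sqrt hx0.le]
  -- (3) the constant
  have hconst : |K| ≤ |K| * (x / Real.log x) * E x := by
    have h1 := hx₂ x hx2x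
    have hsx : 1 ≤ Real.sqrt x := by rw [← Real.sqrt_one]; exact Real.sqrt_le_sqrt hx1
    have h2 : 1 ≤ x / Real.log x * E x := by
      rw [div_mul_eq_mul_div, le_div_iff₀ hlogx0, one_mul]
      calc Real.log x ≤ Real.sqrt x * Real.log x := le_mul_of_one_le_left hlogx0.le hsx
        _ ≤ x * E x := h1
    calc |K| = |K| * 1 := (mul_one _).symm
      _ ≤ |K| * (x / Real.log x * E x) := mul_le_mul_of_nonneg_left h2 (abs_nonneg _)
      _ = |K| * (x / Real.log x) * E x := by ring
  -- (4) assemble: `1/log²x ≤ 1/log x`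
  have h42 : 4 * C * (x / Real.log x ^ 2) * E x ≤ 4 * C * (x / Real.log x) * E x := by
    have : x / Real.log x ^ 2 ≤ x / Real.log x := by
      rw [div_le_div_iff₀ (by positivity) hlogx0]
      nlinarith [mul_nonneg (mul_nonneg hx0.le hlogx0.le) (sub_nonneg.2 hlogx)]
    have h0 : 0 ≤ 4 * C := by positivity
    exact mul_le_mul_of_nonneg_right (mul_le_mul_of_nonneg_left this h0) (hE0 x).le
  rw [hid]
  set a := (θ x - x) / Real.log x with ha
  set b := ∫ t in ξ..x, (θ t - t) / (t * Real.log t ^ 2) with hb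
  calc |a + b - K| ≤ |a + b| + |K| := abs_sub (a + b) K
    _ ≤ |a| + |b| + |K| := by linarith [abs_add_le a b]
    _ ≤ C * (x / Real.log x) * E x + 4 * C * (x / Real.log x) * E x + |K| * (x / Real.log x) * E x := by
        linarith [hbdry, hint.trans h42, hconst]
    _ = (C + 4 * C + |K|) * (x / Real.log x) * E x := by ring

end VKTransfer

/-! ## Bellotti 2026, Corollary 1.6 from Theorem 1.5 -/

namespace Bellotti2026_thm15

open Bellotti2026

/-- **The `π`-clause of Corollary 1.6 from Theorem 1.5** (PROVED): for every admissible `A₀ > 0`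
there are `C, x₀` with `|π(x) − li x| ≤ C (x/log x) exp(−ω(x))` for `x ≥ x₀` — the `ϑ`-clause
(`Bellotti2026_thm15.theta`) transferred with the same exponent (`VKTransfer.primeCounting_of_theta`).
[cite: Bellotti2026ZeroDensity, Cor. 1.6] -/
theorem primeCounting (h : Bellotti2026_thm15) {A₀ : ℝ} (hA₀ : 0 < A₀)
    (hKV : IsKVZeroFreeConstant A₀) :
    ∃ C x₀ : ℝ, ∀ x : ℝ, x₀ ≤ x →
      |(Nat.primeCounting ⌊x⌋₊ : ℝ) - logIntegral x| ≤ C * (x / Real.log x) * Real.exp (-omegaKV A₀ x) := by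
  obtain ⟨C, x₀, hθ⟩ := h.theta hA₀ hKV
  have hd : 0 < dKV A₀ := by unfold dKV; positivity
  -- enlarge the threshold to `max x₀ 0` and the constant to `max C 0`
  have hθ' : ∀ u : ℝ, max x₀ 0 ≤ u → |θ u - u| ≤ max C 0 * u *
      Real.exp (-(dKV A₀ * Real.log u ^ (3 / 5 : ℝ) * Real.log (Real.log u) ^ (-(1 / 5) : ℝ))) := by
    intro u hu
    have hu0 : 0 ≤ u := (le_max_right _ _).trans hu
    have h1 := hθ u ((le_max_left _ _).trans hu)
    rw [omegaKV] at h1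
    exact h1.trans (mul_le_mul_of_nonneg_right (mul_le_mul_of_nonneg_right (le_max_left _ _) hu0)
      (Real.exp_pos _).le)
  obtain ⟨C', x₁, hπ⟩ := VKTransfer.primeCounting_of_theta hd (le_max_right _ _) hθ'
  refine ⟨C', x₁, fun x hx ↦ ?_⟩
  have := hπ x hx
  rwa [omegaKV]

/-- **Bellotti 2026, Corollary 1.6, from Theorem 1.5** (both clauses, PROVED in the tree):
`Bellotti2026_thm15 → Bellotti2026_cor16`. [cite: Bellotti2026ZeroDensity, Cor. 1.6] -/
theorem cor16 (h : Bellotti2026_thm15) : Bellotti2026_cor16 := by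
  intro A₀ hA₀ hKV
  obtain ⟨C₁, x₁, h₁⟩ := h.primeCounting hA₀ hKV
  obtain ⟨C₂, x₂, h₂⟩ := h.theta hA₀ hKV
  refine ⟨max C₁ C₂, max (max x₁ x₂) 3, fun x hx ↦ ⟨?_, ?_⟩⟩
  · have hx₁ : x₁ ≤ x := (le_max_left _ _).trans ((le_max_left _ _).trans hx)
    have hx3 : 3 ≤ x := (le_max_right _ _).trans hx
    have hlog : 0 < Real.log x := Real.log_pos (by linarith)
    have hnn : 0 ≤ x / Real.log x * Real.exp (-omegaKV A₀ x) := by positivity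
    calc |(Nat.primeCounting ⌊x⌋₊ : ℝ) - logIntegral x|
        ≤ C₁ * (x / Real.log x) * Real.exp (-omegaKV A₀ x) := h₁ x hx₁
      _ ≤ max C₁ C₂ * (x / Real.log x) * Real.exp (-omegaKV A₀ x) := by
          rw [mul_assoc, mul_assoc]
          exact mul_le_mul_of_nonneg_right (le_max_left _ _) hnn
  · have hx₂ : x₂ ≤ x := (le_max_right _ _).trans ((le_max_left _ _).trans hx)
    have hx3 : 3 ≤ x := (le_max_right _ _).trans hx
    have hnn : 0 ≤ x * Real.exp (-omegaKV A₀ x) := by positivity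
    calc |θ x - x| ≤ C₂ * x * Real.exp (-omegaKV A₀ x) := h₂ x hx₂
      _ ≤ max C₁ C₂ * x * Real.exp (-omegaKV A₀ x) := by
          rw [mul_assoc, mul_assoc]
          exact mul_le_mul_of_nonneg_right (le_max_right _ _) hnn

end Bellotti2026_thm15

end Literature.NumberTheory.LFunctions

end
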